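import Summits.Ventures.Crystal3D.Theorems.StickyWulffConstantCoaxialWallLawCapCheckerCoverLemmas
import HarnessLib

/-!
# The ccw-polygon certificate for the pin lemma's support form (checker `capcc`, crux `CoaxialWallLaw`, stmt-Ventures-19481)

HONEST FRAMING. Venture `Summits/Ventures/Crystal3D` (cell `crystal3d-full`); helper `--supports` the crux `CoaxialWallLaw`
(stmt-Ventures-19481, `route-Ventures-StickyWulffConstant`), registered line 'CoaxialWallLawCertificates' (planner cf-p1, stub
`stub_lensCert`); third file of the checker-soundness series ('…CapCheckerLemmas' (L1)(L2), '…CapCheckerCoverLemmas' (L3)(L4)).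
PURPOSE.  (L3) (`CapChecker.inner_le_pinThreshold`) consumes the SUPPORT form «every tangent vector `d ⊥ e`, `d ≠ 0`, has an active
blocker `w` with `μ‖d‖‖w‖²/2 ≤ ⟪d, w⟫» — a statement over all directions `d`, not finitely checkable as such.  cf-p2's `capcc.pinned_exclusions`
certifies it by a planar convex-hull computation (in-radius `μ` of the hull of the scaled tangential parts `a_w`).  This file proves that a
FINITE, rational certificate suffices: a cyclic list `Q_0, …, Q_{n−1}` of scaled tangential parts, counter-clockwise about `e`
(`ω(Q_i, Q_{i+1}) > 0` for an orientation form `ω`) whose edge LINES stay at squared distance `≥ ν` from the origin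
(`ν‖Q_{i+1} − Q_i‖² ≤ ‖Q_i‖²‖Q_{i+1} − Q_i‖² − ⟪Q_i, Q_{i+1} − Q_i⟫²`, Lagrange's identity) gives the support form with `μ = √ν`.
The orientation form is abstract: any `ω : V → V → ℝ`, antisymmetric, satisfying the planar three-term (Grassmann–Plücker) relation
`ω(Q_i, Q_{i+1}) d + ω(Q_{i+1}, d) Q_i + ω(d, Q_i) Q_{i+1} = 0` for tangent `d` — for coordinate triples and `ω(a, b) = det(e, a, b)` this is
the four-vector identity of `ℝ³` paired with `e` (a `ring` computation the checker's data file supplies; any inner product, e.g. cf-p2's module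
metric `diag(¼, 1/12, ⅙)`, works).  ORIENTATION IS ESSENTIAL: the orientation-free variant «`0 ∈ conv{Q_i}` + chain edge lines far from `0`» is
false (planar counterexample `(0.1, 1), (−3, 2), (0.1, −1), (−3, −2)` in chain order: edge-line distances `≥ 0.65`, support in direction `(1, 0)`
only `0.1`).
* `no_strictMono_cycle` — no real sequence increases strictly around a cycle;
  `sign_dichotomy_cycle` — on a cycle either some index has `c_i ≥ 0 ≥ c_{i+1}`, or all `c_i > 0`, or all `c_i < 0`.
* `norm_sq_lineDist_le` — Lagrange: every point `Q + θE` of a line has `‖Q‖²‖E‖² − ⟪Q, E⟫² ≤ ‖Q + θE‖²‖E‖²`.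
* **`exists_sector_of_ccwCycle`** — sector location: a tangent `d ≠ 0` is a nonnegative, nontrivial combination of some consecutive
  pair `Q_i, Q_{i+1}` of a ccw cycle (reused by the pair rule's fan certificate).
* **`exists_le_inner_of_ccwPolygon`** — the certificate lemma: for every tangent `d ≠ 0` some vertex has `√ν‖d‖ ≤ ⟪d, Q_i⟫`.
* **`inner_le_pinThreshold_of_ccwPolygon`** — plugged into (L3): with `Q_i = (2/‖w_i‖²)(w_i − ⟪w_i, e⟫e)` for active blockers `w_i`, every
  free unit `u ≠ e` has `⟪u, e⟫ ≤ (1 − ν)/(1 + ν)`; `eq_of_mem_pinCap_of_ccwPolygon` — the open pin cap `{(1 − ν)/(1 + ν) < ⟪x, e⟫}` holds no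
  free unit vector but `e`.
Proof of the certificate lemma: with `c_i = ω(Q_i, d)`, if all `c_i c_{i+1} > 0` then pairing the three-term relation with `d` makes
`⟪Q_i, d⟫/c_i` strictly monotone around the cycle — absurd; so some `i` has `c_i ≥ 0 ≥ c_{i+1}`, the relation writes
`ω(Q_i, Q_{i+1}) d = (−c_{i+1}) Q_i + c_i Q_{i+1}` with nonnegative coefficients, the rescaled `x = d/σ` lies on the edge, `‖x‖² ≥ ν` by
Lagrange, and `⟪d, x⟫ = ‖d‖‖x‖ ≥ √ν‖d‖` is a convex combination of `⟪d, Q_i⟫, ⟪d, Q_{i+1}⟫`.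
WHAT THIS IS NOT: not the checker and not its coordinate instantiation of `ω`; no statement about types, tables or packings; F-C1 not moved.
-/

namespace Summit.Ventures.Crystal3D.Theorems

namespace CapChecker

open Finset
open scoped InnerProductSpace

variable {V : Type*} [NormedAddCommGroup V] [InnerProductSpace ℝ V]

/-! ### Cyclic bookkeeping -/

/-- No real sequence increases strictly all the way around a cycle. -/
theorem no_strictMono_cycle {r : ℕ → ℝ} {n : ℕ} (hn : 0 < n) (hper : r n = r 0) (hlt : ∀ i < n, r i < r (i + 1)) :
    False := by
  have h : ∀ k, k ≤ n → 1 ≤ k → r 0 < r k := by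
    intro k
    induction k with
    | zero => intro _ h; exact absurd h (by norm_num)
    | succ k ih =>
      intro hk _
      rcases Nat.eq_zero_or_pos k with h0 | h0
      · subst h0; exact hlt 0 hn
      · exact (ih (Nat.le_of_succ_le hk) h0).trans (hlt k (Nat.lt_of_succ_le hk))
  have := h n le_rfl hn
  rw [hper] at this
  exact lt_irrefl _ this

/-- **Sign dichotomy on a cycle.**  For a real sequence `c` with `c n = c 0`: either some `i < n` has `c i ≥ 0 ≥ c (i + 1)`, or all
`c i > 0` (`i ≤ n`), or all `c i < 0` (`i ≤ n`). -/
theorem sign_dichotomy_cycle {c : ℕ → ℝ} {n : ℕ} (hn : 0 < n) (hper : c n = c 0) :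
    (∃ i < n, 0 ≤ c i ∧ c (i + 1) ≤ 0) ∨ (∀ i ≤ n, 0 < c i) ∨ (∀ i ≤ n, c i < 0) := by
  by_cases hgood : ∃ i < n, 0 ≤ c i ∧ c (i + 1) ≤ 0
  · exact Or.inl hgood
  push Not at hgood
  -- no good index: nonnegativity at `i < n` forces negativity at `i + 1`... contrapositively, `c i ≥ 0 ⇒ c (i+1) > 0`
  have hstep : ∀ i < n, 0 ≤ c i → 0 < c (i + 1) := fun i hi h => hgood i hi h
  right
  rcases le_or_gt 0 (c 0) with h0 | h0
  · -- all positive: propagate forward from `c 0 ≥ 0`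
    left
    have hpos : ∀ k, k ≤ n → 1 ≤ k → 0 < c k := by
      intro k
      induction k with
      | zero => intro _ h; exact absurd h (by norm_num)
      | succ k ih =>
        intro hk _
        rcases Nat.eq_zero_or_pos k with hk0 | hk0
        · subst hk0; exact hstep 0 hn h0
        · exact hstep k (Nat.lt_of_succ_le hk) (ih (Nat.le_of_succ_le hk) hk0).le
    intro i hi
    rcases Nat.eq_zero_or_pos i with hi0 | hi0
    · subst hi0; rw [← hper]; exact hpos n le_rfl hn
    · exact hpos i hi hi0
  · -- all negative: propagate backward from `c n = c 0 < 0` (if `c i ≥ 0` for some `i < n` then `c n > 0`)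
    right
    have hneg : ∀ i < n, c i < 0 := by
      intro i hi
      by_contra h
      push Not at h
      -- forward propagation from `i` to `n`
      have hpos : ∀ k, i + k ≤ n → 1 ≤ k → 0 < c (i + k) := by
        intro k
        induction k with
        | zero => intro _ h; exact absurd h (by norm_num)
        | succ k ih =>
          intro hk _
          rcases Nat.eq_zero_or_pos k with hk0 | hk0
          · subst hk0; exact hstep i hi h
          · have := ih (by omega) hk0
            rw [← add_assoc]
            exact hstep (i + k) (by omega) this.le
      have := hpos (n - i) (by omega) (by omega)
      rw [show i + (n - i) = n by omega, hper] at this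
      linarith
    intro i hi
    rcases hi.lt_or_eq with hi' | hi'
    · exact hneg i hi'
    · rw [hi', hper]; exact h0

/-! ### Lagrange's bound for the distance from the origin to a line -/

/-- **Lagrange.**  For every point `Q + θE` of the line through `Q` with direction `E`:
`‖Q‖²‖E‖² − ⟪Q, E⟫² ≤ ‖Q + θE‖²·‖E‖²` (the left side is `dist(0, line)²·‖E‖²`; the difference is `(θ‖E‖² + ⟪Q, E⟫)²`). -/
theorem norm_sq_lineDist_le (Q E : V) (θ : ℝ) :
    ‖Q‖ ^ 2 * ‖E‖ ^ 2 - ⟪Q, E⟫_ℝ ^ 2 ≤ ‖Q + θ • E‖ ^ 2 * ‖E‖ ^ 2 := by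
  have h : ‖Q + θ • E‖ ^ 2 = ‖Q‖ ^ 2 + 2 * θ * ⟪Q, E⟫_ℝ + θ ^ 2 * ‖E‖ ^ 2 := by
    rw [← real_inner_self_eq_norm_sq, ← real_inner_self_eq_norm_sq, ← real_inner_self_eq_norm_sq]
    simp only [inner_add_left, inner_add_right, real_inner_smul_left, real_inner_smul_right, real_inner_comm Q E]
    ring
  rw [h]
  nlinarith [sq_nonneg (θ * ‖E‖ ^ 2 + ⟪Q, E⟫_ℝ)]

/-! ### Sector location on a ccw cycle -/

/-- **Sector location.**  `Q : ℕ → V` a cyclic list of period `n > 0`; `ω` an antisymmetric form satisfying the planar three-term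
relation against the vector `d ≠ 0`; every consecutive pair counter-clockwise (`0 < ω (Q i) (Q (i+1))`).  Then `d`
lies in some sector: `d = α Q i + β Q (i+1)` with `α, β ≥ 0`, `α + β > 0`, `i < n`.  Proof: with `c_i = ω(Q_i, d)`, if all
`c_i c_{i+1} > 0` then pairing the three-term relation with `d` makes `⟪Q_i, d⟫/c_i` strictly increasing around the cycle — absurd; so
some `i` has `c_i ≥ 0 ≥ c_{i+1}`, where the relation reads `ω(Q_i, Q_{i+1}) d = (−c_{i+1}) Q_i + c_i Q_{i+1}`. -/
theorem exists_sector_of_ccwCycle {n : ℕ} (hn : 0 < n) {Q : ℕ → V} (hper : ∀ i, Q (i + n) = Q i)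
    {ω : V → V → ℝ} (halt : ∀ a b, ω a b = -ω b a) {d : V}
    (hpl : ∀ i, ω (Q i) (Q (i + 1)) • d + ω (Q (i + 1)) d • Q i + ω d (Q i) • Q (i + 1) = 0)
    (hccw : ∀ i < n, 0 < ω (Q i) (Q (i + 1))) (hd0 : d ≠ 0) :
    ∃ i < n, ∃ α β : ℝ, 0 ≤ α ∧ 0 ≤ β ∧ 0 < α + β ∧ d = α • Q i + β • Q (i + 1) := by
  have hdd : 0 < ‖d‖ ^ 2 := by positivity
  -- the decomposition `ω(Q_i, Q_{i+1}) d = (−c_{i+1}) Q_i + c_i Q_{i+1}`, `c_i = ω (Q i) d`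
  set c : ℕ → ℝ := fun i => ω (Q i) d with hc
  have hdec : ∀ i, ω (Q i) (Q (i + 1)) • d = (-c (i + 1)) • Q i + c i • Q (i + 1) := by
    intro i
    have h := hpl i
    have h2 : ω d (Q i) = -c i := by simp only [hc]; exact halt d (Q i)
    rw [h2] at h
    simp only [hc, neg_smul] at h ⊢
    rw [add_assoc, add_eq_zero_iff_eq_neg] at h
    rw [h]
    abel
  have hcper : c n = c 0 := by simp only [hc]; rw [← zero_add n, hper 0]
  -- Step 1: a good index exists
  have hgood : ∃ i < n, 0 ≤ c i ∧ c (i + 1) ≤ 0 := by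
    rcases sign_dichotomy_cycle hn hcper with h | h | h
    · exact h
    all_goals
      exfalso
      have hprod : ∀ i < n, 0 < c i * c (i + 1) := by
        intro i hi
        first
        | exact mul_pos (h i hi.le) (h (i + 1) hi)
        | exact mul_pos_of_neg_of_neg (h i hi.le) (h (i + 1) hi)
      refine no_strictMono_cycle (r := fun i => ⟪Q i, d⟫_ℝ / c i) hn ?_ ?_
      · show ⟪Q n, d⟫_ℝ / c n = ⟪Q 0, d⟫_ℝ / c 0
        rw [hcper, ← zero_add n, hper 0]
      · intro i hi
        have hD := hccw i hi
        have hci : c i ≠ 0 := fun h0 => by have := hprod i hi; rw [h0, zero_mul] at this; exact lt_irrefl 0 this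
        have hci1 : c (i + 1) ≠ 0 := fun h0 => by
          have := hprod i hi; rw [h0, mul_zero] at this; exact lt_irrefl 0 this
        have hpair : ω (Q i) (Q (i + 1)) * ‖d‖ ^ 2 = -c (i + 1) * ⟪Q i, d⟫_ℝ + c i * ⟪Q (i + 1), d⟫_ℝ := by
          have h := congrArg (fun z => ⟪z, d⟫_ℝ) (hdec i)
          simp only [real_inner_smul_left, inner_add_left, real_inner_self_eq_norm_sq] at h
          linarith
        have hlt : 0 < -c (i + 1) * ⟪Q i, d⟫_ℝ + c i * ⟪Q (i + 1), d⟫_ℝ := by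
          rw [← hpair]; exact mul_pos hD hdd
        show ⟪Q i, d⟫_ℝ / c i < ⟪Q (i + 1), d⟫_ℝ / c (i + 1)
        rw [← sub_pos, div_sub_div _ _ hci1 hci]
        refine div_pos ?_ (by rw [mul_comm]; exact hprod i hi)
        linarith
  -- Step 2: at a good index, `d` is a nonnegative combination of `Q i`, `Q (i+1)`
  obtain ⟨i, hi, hci, hci1⟩ := hgood
  have hDpos : 0 < ω (Q i) (Q (i + 1)) := hccw i hi
  refine ⟨i, hi, -c (i + 1) / ω (Q i) (Q (i + 1)), c i / ω (Q i) (Q (i + 1)), div_nonneg (by linarith) hDpos.le,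
    div_nonneg hci hDpos.le, ?_, ?_⟩
  · -- `α + β > 0`, else `d = 0`
    rw [← add_div]
    refine div_pos ?_ hDpos
    rcases (show 0 ≤ -c (i + 1) + c i by linarith).lt_or_eq with h | h
    · exact h
    · exfalso
      have ha : c i = 0 := by linarith
      have hb : c (i + 1) = 0 := by linarith
      have h0 := hdec i
      rw [ha, hb, neg_zero, zero_smul, zero_smul, add_zero] at h0
      exact hd0 ((smul_eq_zero.1 h0).resolve_left hDpos.ne')
  · have h := hdec i
    have h2 : d = (ω (Q i) (Q (i + 1)))⁻¹ • (ω (Q i) (Q (i + 1)) • d) := by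
      rw [smul_smul, inv_mul_cancel₀ hDpos.ne', one_smul]
    rw [h2, h, smul_add, smul_smul, smul_smul, div_eq_inv_mul, div_eq_inv_mul]

/-! ### The certificate lemma -/

/-- **The ccw-polygon certificate gives the support form.**  `Q : ℕ → V` a cyclic list of period `n > 0`; `ω` an antisymmetric form
satisfying the planar three-term relation against every tangent `d ⊥ e`; every consecutive pair counter-clockwise (`0 < ω (Q i) (Q (i+1))`)
with edge line at squared distance `≥ ν` from the origin (Lagrange form).  Then every tangent `d ≠ 0` has a vertex with
`√ν·‖d‖ ≤ ⟪d, Q i⟫` (`√ν = 0` for `ν ≤ 0`). -/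
theorem exists_le_inner_of_ccwPolygon {e : V} {n : ℕ} (hn : 0 < n) {Q : ℕ → V} (hper : ∀ i, Q (i + n) = Q i)
    {ω : V → V → ℝ} (halt : ∀ a b, ω a b = -ω b a)
    (hpl : ∀ d : V, ⟪d, e⟫_ℝ = 0 → ∀ i, ω (Q i) (Q (i + 1)) • d + ω (Q (i + 1)) d • Q i + ω d (Q i) • Q (i + 1) = 0)
    (hccw : ∀ i < n, 0 < ω (Q i) (Q (i + 1))) {ν : ℝ}
    (hdist : ∀ i < n, ν * ‖Q (i + 1) - Q i‖ ^ 2 ≤ ‖Q i‖ ^ 2 * ‖Q (i + 1) - Q i‖ ^ 2 - ⟪Q i, Q (i + 1) - Q i⟫_ℝ ^ 2)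
    {d : V} (hde : ⟪d, e⟫_ℝ = 0) (hd0 : d ≠ 0) :
    ∃ i < n, Real.sqrt ν * ‖d‖ ≤ ⟪d, Q i⟫_ℝ := by
  obtain ⟨i, hi, α, β, hα0, hβ0, hσpos, hdαβ⟩ := exists_sector_of_ccwCycle hn hper halt (hpl d hde) hccw hd0
  have hDpos : 0 < ω (Q i) (Q (i + 1)) := hccw i hi
  set σ := α + β with hσ
  -- the edge point `x = σ⁻¹ d = Q i + θ (Q (i+1) − Q i)`, `θ = β/σ`
  set E := Q (i + 1) - Q i with hE
  have hx : σ⁻¹ • d = Q i + (β / σ) • E := by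
    rw [hdαβ, hE, smul_sub, smul_add, smul_smul, smul_smul]
    have h1 : σ⁻¹ * α = 1 - β / σ := by
      field_simp
      rw [hσ]
      ring
    rw [h1, div_eq_inv_mul, sub_smul, one_smul]
    abel
  -- `‖x‖² ≥ ν`
  have hE0 : E ≠ 0 := by
    intro h0
    have hQ : Q (i + 1) = Q i := sub_eq_zero.1 (by rw [← hE, h0])
    have : ω (Q i) (Q (i + 1)) = 0 := by
      rw [hQ]
      have := halt (Q i) (Q i)
      linarith
    exact absurd this hDpos.ne'
  have hEpos : 0 < ‖E‖ ^ 2 := by positivity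
  have hxsq : ν ≤ ‖σ⁻¹ • d‖ ^ 2 := by
    have h1 := norm_sq_lineDist_le (Q i) E (β / σ)
    rw [← hx] at h1
    have h2 := hdist i hi
    rw [← hE] at h2
    nlinarith
  have hxn : Real.sqrt ν ≤ σ⁻¹ * ‖d‖ := by
    have h := Real.sqrt_le_sqrt hxsq
    rwa [Real.sqrt_sq (norm_nonneg _), norm_smul, norm_inv, Real.norm_of_nonneg hσpos.le] at h
  -- `⟪d, x⟫ = ‖d‖·‖x‖ ≥ √ν ‖d‖`, and `⟪d, x⟫` is a convex combination of `⟪d, Q i⟫`, `⟪d, Q (i+1)⟫`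
  have hdx : ⟪d, σ⁻¹ • d⟫_ℝ = σ⁻¹ * ‖d‖ * ‖d‖ := by
    rw [real_inner_smul_right, real_inner_self_eq_norm_sq]; ring
  have hlow : Real.sqrt ν * ‖d‖ ≤ ⟪d, σ⁻¹ • d⟫_ℝ := by
    rw [hdx]
    exact mul_le_mul_of_nonneg_right hxn (norm_nonneg d)
  have hcomb : ⟪d, σ⁻¹ • d⟫_ℝ = (α / σ) * ⟪d, Q i⟫_ℝ + (β / σ) * ⟪d, Q (i + 1)⟫_ℝ := by
    have h : σ⁻¹ • d = (α / σ) • Q i + (β / σ) • Q (i + 1) := by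
      conv_lhs => rw [hdαβ]
      rw [smul_add, smul_smul, smul_smul, div_eq_inv_mul, div_eq_inv_mul]
    rw [h, inner_add_right, real_inner_smul_right, real_inner_smul_right]
  have hw1 : α / σ + β / σ = 1 := by rw [← add_div, hσ, div_self hσpos.ne']
  have hw0a : 0 ≤ α / σ := div_nonneg hα0 hσpos.le
  have hw0b : 0 ≤ β / σ := div_nonneg hβ0 hσpos.le
  by_cases hQi : Real.sqrt ν * ‖d‖ ≤ ⟪d, Q i⟫_ℝ
  · exact ⟨i, hi, hQi⟩
  · push Not at hQi
    have hQi1 : Real.sqrt ν * ‖d‖ ≤ ⟪d, Q (i + 1)⟫_ℝ := by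
      by_contra h
      push Not at h
      have hlt : (α / σ) * ⟪d, Q i⟫_ℝ + (β / σ) * ⟪d, Q (i + 1)⟫_ℝ <
          (α / σ) * (Real.sqrt ν * ‖d‖) + (β / σ) * (Real.sqrt ν * ‖d‖) := by
        rcases hw0a.lt_or_eq with ha | ha
        · exact add_lt_add_of_lt_of_le (mul_lt_mul_of_pos_left hQi ha) (mul_le_mul_of_nonneg_left h.le hw0b)
        · have hb : 0 < β / σ := by rw [← ha] at hw1; linarith
          exact add_lt_add_of_le_of_lt (mul_le_mul_of_nonneg_left hQi.le hw0a) (mul_lt_mul_of_pos_left h hb)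
      rw [← add_mul, hw1, one_mul, ← hcomb] at hlt
      linarith
    -- the index `i + 1`, reduced mod `n`
    rcases Nat.lt_or_ge (i + 1) n with h1 | h1
    · exact ⟨i + 1, h1, hQi1⟩
    · have hieq : i + 1 = n := by omega
      refine ⟨0, hn, ?_⟩
      rw [hieq, ← zero_add n, hper 0] at hQi1
      exact hQi1

/-! ### Plugging the certificate into (L3) -/

/-- **(L3) with the ccw-polygon certificate.**  `e` unit; `W : ℕ → V` a cyclic list (period `n > 0`) of nonzero blockers active at `e`
(`⟪e, W i⟫ = ‖W i‖²/2`); `Q i = (2/‖W i‖²)(W i − ⟪W i, e⟫e)` their scaled tangential parts; `ω` antisymmetric with the three-term relation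
against tangent vectors; all consecutive pairs ccw (`0 < ω (Q i) (Q (i+1))`) with edge lines at squared distance `≥ ν ≥ 0` from `0`
(Lagrange form).  Then every unit `u ≠ e` respecting the listed blockers (`⟪u, W i⟫ ≤ ‖W i‖²/2`) has `⟪u, e⟫ ≤ (1 − ν)/(1 + ν)`. -/
theorem inner_le_pinThreshold_of_ccwPolygon {e u : V} {n : ℕ} (hn : 0 < n) {W Q : ℕ → V} (hWper : ∀ i, W (i + n) = W i)
    (hW : ∀ i < n, W i ≠ 0 ∧ ⟪e, W i⟫_ℝ = ‖W i‖ ^ 2 / 2) (hQ : ∀ i, Q i = (2 / ‖W i‖ ^ 2) • (W i - ⟪W i, e⟫_ℝ • e))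
    {ω : V → V → ℝ} (halt : ∀ a b, ω a b = -ω b a)
    (hpl : ∀ d : V, ⟪d, e⟫_ℝ = 0 → ∀ i, ω (Q i) (Q (i + 1)) • d + ω (Q (i + 1)) d • Q i + ω d (Q i) • Q (i + 1) = 0)
    (hccw : ∀ i < n, 0 < ω (Q i) (Q (i + 1))) {ν : ℝ} (hν : 0 ≤ ν)
    (hdist : ∀ i < n, ν * ‖Q (i + 1) - Q i‖ ^ 2 ≤ ‖Q i‖ ^ 2 * ‖Q (i + 1) - Q i‖ ^ 2 - ⟪Q i, Q (i + 1) - Q i⟫_ℝ ^ 2)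
    (he : ‖e‖ = 1) (hu : ‖u‖ = 1) (hne : u ≠ e) (hfree : ∀ i < n, ⟪u, W i⟫_ℝ ≤ ‖W i‖ ^ 2 / 2) :
    ⟪u, e⟫_ℝ ≤ (1 - ν) / (1 + ν) := by
  have hQper : ∀ i, Q (i + n) = Q i := fun i => by rw [hQ, hQ, hWper]
  have hμ2 : Real.sqrt ν ^ 2 = ν := Real.sq_sqrt hν
  rw [← hμ2]
  refine inner_le_pinThreshold (A := {w | ∃ i < n, w = W i}) he hu hne (Real.sqrt_nonneg ν) ?_ ?_ ?_
  · rintro w ⟨i, hi, rfl⟩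
    exact hW i hi
  · intro d hde hd0
    obtain ⟨i, hi, hle⟩ := exists_le_inner_of_ccwPolygon (e := e) (Q := Q) hn hQper halt hpl hccw hdist hde hd0
    refine ⟨W i, ⟨i, hi, rfl⟩, ?_⟩
    have hwpos : 0 < ‖W i‖ := norm_pos_iff.2 (hW i hi).1
    have h2 : 0 < ‖W i‖ ^ 2 / 2 := by positivity
    have h := mul_le_mul_of_nonneg_right hle h2.le
    rw [hQ, inner_scaledTangent hde] at h
    have hid : 2 / ‖W i‖ ^ 2 * ⟪d, W i⟫_ℝ * (‖W i‖ ^ 2 / 2) = ⟪d, W i⟫_ℝ := by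
      field_simp
    rw [hid] at h
    exact h
  · rintro w ⟨i, hi, rfl⟩
    exact hfree i hi

/-- **Pin cap from the ccw-polygon certificate.**  Under the hypotheses of `inner_le_pinThreshold_of_ccwPolygon`, a unit vector in the open
pin cap `{x : (1 − ν)/(1 + ν) < ⟪x, e⟫}` respecting the listed blockers is `e` itself (hence, `e` being forbidden, no witness). -/
theorem eq_of_mem_pinCap_of_ccwPolygon {e u : V} {n : ℕ} (hn : 0 < n) {W Q : ℕ → V} (hWper : ∀ i, W (i + n) = W i)
    (hW : ∀ i < n, W i ≠ 0 ∧ ⟪e, W i⟫_ℝ = ‖W i‖ ^ 2 / 2) (hQ : ∀ i, Q i = (2 / ‖W i‖ ^ 2) • (W i - ⟪W i, e⟫_ℝ • e))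
    {ω : V → V → ℝ} (halt : ∀ a b, ω a b = -ω b a)
    (hpl : ∀ d : V, ⟪d, e⟫_ℝ = 0 → ∀ i, ω (Q i) (Q (i + 1)) • d + ω (Q (i + 1)) d • Q i + ω d (Q i) • Q (i + 1) = 0)
    (hccw : ∀ i < n, 0 < ω (Q i) (Q (i + 1))) {ν : ℝ} (hν : 0 ≤ ν)
    (hdist : ∀ i < n, ν * ‖Q (i + 1) - Q i‖ ^ 2 ≤ ‖Q i‖ ^ 2 * ‖Q (i + 1) - Q i‖ ^ 2 - ⟪Q i, Q (i + 1) - Q i⟫_ℝ ^ 2)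
    (he : ‖e‖ = 1) (hu : ‖u‖ = 1) (hfree : ∀ i < n, ⟪u, W i⟫_ℝ ≤ ‖W i‖ ^ 2 / 2)
    (hcap : (1 - ν) / (1 + ν) < ⟪u, e⟫_ℝ) : u = e := by
  by_contra hne
  have h := inner_le_pinThreshold_of_ccwPolygon hn hWper hW hQ halt hpl hccw hν hdist he hu hne hfree
  linarith

end CapChecker

end Summit.Ventures.Crystal3D.Theorems
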